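import Summits.RiemannHypothesis.RiemannHypothesis.Theorems.SemilocalLogAtomsC
import HarnessLib

/-!
# Semi-local negative certificates: the atoms `53, 59, 61, 64` (enclosures, once and for all)

Cell `rh-explicit` (HOME `run/shared/lean/pub/rh-explicit/`), seat cc-s2-4 gen8 (A4-EXT, the Lean side: atom tables for the walls
`q = 59, 61, 67` on the WIDE windows `b ≤ 4` of `SemilocalNegCertWide.lean`).  Companion of `SemilocalLogAtoms{,B,C}.lean`
(atoms `2 … 49`): the rational atom table entries `(n, lo, hi, wlo, whi)` for the primes `53, 59, 61` and the prime power
`64 = 2⁶`, each with its enclosure lemma for an ARBITRARY `S` containing the atom's prime: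

* `log 53` (6.1e-10), `log 59`, `log 61` (4.1e-10) by Mathlib's `Real.abs_log_sub_add_sum_range_le` at `53 = 54(1 − 1/54)`,
  `59 = 60(1 − 1/60)`, `61 = 60(1 + 1/60)` (7 terms) with `log 2` (d20), `log 3`, `log 5` (Mathlib, 1e-10);
* `√53, √59, √61` by squaring sixteen-digit decimals; `√64 = 8`;
* atoms `atomFiftyThree, atomFiftyNine, atomSixtyOne, atomSixtyFour` and the generic enclosure lemmas.

Folklore numerics throughout; nothing here bears on RH.
-/

set_option autoImplicit false
set_option linter.dupNamespace false  -- the mandated namespace repeats `RiemannHypothesis`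

noncomputable section

namespace Summit.RiemannHypothesis.RiemannHypothesis.Theorems.SemilocalPolyWitness

open Real
open Literature.NumberTheory.LFunctions
open Literature.Analysis.SpecialFunctions.Real
open Summit.RiemannHypothesis.RiemannHypothesis.Theorems.MotivicDoor.SemilocalMarkov

/-! ### The atom `53` (`log 53` from `53 = 54·(1 − 1/54)`) -/

/-- `(3.97029191325) < log 53` (`Real.abs_log_sub_add_sum_range_le` at `x = 1/54`, 7 terms). -/
theorem log_fiftythree_gt : (3.97029191325 : ℝ) < Real.log 53 := by
  have t : |((1 : ℝ) / 54)| < 1 := by rw [abs_of_pos (by norm_num)]; norm_num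
  have z := Real.abs_log_sub_add_sum_range_le t 7
  rw [abs_of_pos (by norm_num : (0 : ℝ) < 1 / 54)] at z
  norm_num [Finset.sum_range_succ] at z
  have e : Real.log (53 / 54) = Real.log 53 - (Real.log 2 + 3 * Real.log 3) := by
    rw [Real.log_div (by norm_num) (by norm_num), show (54 : ℝ) = 2 * 3 ^ 3 by norm_num, Real.log_mul (by norm_num) (by norm_num), Real.log_pow]
    push_cast; ring
  rw [e] at z
  have h2 := Literature.Analysis.SpecialFunctions.Real.log_two_gt_d20
  have h3 := logThreeLo_le
  rw [logThreeLo] at h3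
  push_cast at h3
  obtain ⟨z1, z2⟩ := abs_le.1 z
  linarith

/-- `log 53 < 3.97029191386` (`Real.abs_log_sub_add_sum_range_le` at `x = 1/54`, 7 terms). -/
theorem log_fiftythree_lt : Real.log 53 < 3.97029191386 := by
  have t : |((1 : ℝ) / 54)| < 1 := by rw [abs_of_pos (by norm_num)]; norm_num
  have z := Real.abs_log_sub_add_sum_range_le t 7
  rw [abs_of_pos (by norm_num : (0 : ℝ) < 1 / 54)] at z
  norm_num [Finset.sum_range_succ] at z
  have e : Real.log (53 / 54) = Real.log 53 - (Real.log 2 + 3 * Real.log 3) := by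
    rw [Real.log_div (by norm_num) (by norm_num), show (54 : ℝ) = 2 * 3 ^ 3 by norm_num, Real.log_mul (by norm_num) (by norm_num), Real.log_pow]
    push_cast; ring
  rw [e] at z
  have h2 := Literature.Analysis.SpecialFunctions.Real.log_two_lt_d20
  have h3 := log_three_le_logThreeHi
  rw [logThreeHi] at h3
  push_cast at h3
  obtain ⟨z1, z2⟩ := abs_le.1 z
  linarith

/-- lower decimal of `log 53` -/
def logFiftyThreeLo : ℚ := 397029191325 / 100000000000
/-- upper decimal of `log 53` -/
def logFiftyThreeHi : ℚ := 397029191386 / 100000000000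
/-- `logFiftyThreeLo ≤ log 53`. -/
theorem logFiftyThreeLo_le : (logFiftyThreeLo : ℝ) ≤ Real.log 53 := by
  rw [logFiftyThreeLo]; push_cast; linarith [log_fiftythree_gt]
/-- `log 53 ≤ logFiftyThreeHi`. -/
theorem log_fiftythree_le_logFiftyThreeHi : Real.log 53 ≤ (logFiftyThreeHi : ℝ) := by
  rw [logFiftyThreeHi]; push_cast; linarith [log_fiftythree_lt]
/-- `7.2801098892805182 ≤ √53 ≤ 7.2801098892805183`. -/
def sqrtFiftyThreeLo : ℚ := 72801098892805182 / 10000000000000000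
/-- upper decimal of `√53` -/
def sqrtFiftyThreeHi : ℚ := 72801098892805183 / 10000000000000000
/-- The atom `53`: weight `log 53/√53`. -/
def atomFiftyThree : ℕ × AtomQ :=
  (53, ⟨logFiftyThreeLo, logFiftyThreeHi, logFiftyThreeLo / sqrtFiftyThreeHi, logFiftyThreeHi / sqrtFiftyThreeLo⟩)
/-- `atomFiftyThree` encloses the atom `53` for any `S ∋ 53`. -/
theorem atomFiftyThree_encl {S : Finset ℕ} (h : 53 ∈ S) :
    (atomFiftyThree.2.lo : ℝ) ≤ Real.log atomFiftyThree.1 ∧ Real.log atomFiftyThree.1 ≤ (atomFiftyThree.2.hi : ℝ) ∧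
      (atomFiftyThree.2.wlo : ℝ) ≤ weilSemilocalCoeff S atomFiftyThree.1 ∧
      weilSemilocalCoeff S atomFiftyThree.1 ≤ (atomFiftyThree.2.whi : ℝ) := by
  simp only [atomFiftyThree]
  push_cast
  have h0 := prime_atom_encl (by norm_num : Nat.Prime 53) h (lo := logFiftyThreeLo) (hi := logFiftyThreeHi)
    (slo := sqrtFiftyThreeLo) (shi := sqrtFiftyThreeHi) (by exact_mod_cast logFiftyThreeLo_le)
    (by exact_mod_cast log_fiftythree_le_logFiftyThreeHi) (by rw [logFiftyThreeLo]; norm_num)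
    (ratCast_le_sqrt (by rw [sqrtFiftyThreeLo]; norm_num) (by rw [sqrtFiftyThreeLo]; norm_num))
    (sqrt_le_ratCast (by rw [sqrtFiftyThreeHi]; norm_num) (by rw [sqrtFiftyThreeHi]; norm_num))
    (by rw [sqrtFiftyThreeLo]; norm_num)
  push_cast at h0
  exact h0

/-! ### The atom `59` (`log 59` from `59 = 60·(1 − 1/60)`) -/

/-- `(4.07753744370) < log 59` (`Real.abs_log_sub_add_sum_range_le` at `x = 1/60`, 7 terms). -/
theorem log_fiftynine_gt : (4.07753744370 : ℝ) < Real.log 59 := by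
  have t : |((1 : ℝ) / 60)| < 1 := by rw [abs_of_pos (by norm_num)]; norm_num
  have z := Real.abs_log_sub_add_sum_range_le t 7
  rw [abs_of_pos (by norm_num : (0 : ℝ) < 1 / 60)] at z
  norm_num [Finset.sum_range_succ] at z
  have e : Real.log (59 / 60) = Real.log 59 - (2 * Real.log 2 + Real.log 3 + Real.log 5) := by
    rw [Real.log_div (by norm_num) (by norm_num), show (60 : ℝ) = 2 ^ 2 * 3 * 5 by norm_num,
      Real.log_mul (by norm_num) (by norm_num), Real.log_mul (by norm_num) (by norm_num), Real.log_pow]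
    push_cast; ring
  rw [e] at z
  have h2 := Literature.Analysis.SpecialFunctions.Real.log_two_gt_d20
  have h3 := logThreeLo_le
  rw [logThreeLo] at h3
  push_cast at h3
  have h5 := logFiveLo_le
  rw [logFiveLo] at h5
  push_cast at h5
  obtain ⟨z1, z2⟩ := abs_le.1 z
  linarith

/-- `log 59 < 4.07753744411` (`Real.abs_log_sub_add_sum_range_le` at `x = 1/60`, 7 terms). -/
theorem log_fiftynine_lt : Real.log 59 < 4.07753744411 := by
  have t : |((1 : ℝ) / 60)| < 1 := by rw [abs_of_pos (by norm_num)]; norm_num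
  have z := Real.abs_log_sub_add_sum_range_le t 7
  rw [abs_of_pos (by norm_num : (0 : ℝ) < 1 / 60)] at z
  norm_num [Finset.sum_range_succ] at z
  have e : Real.log (59 / 60) = Real.log 59 - (2 * Real.log 2 + Real.log 3 + Real.log 5) := by
    rw [Real.log_div (by norm_num) (by norm_num), show (60 : ℝ) = 2 ^ 2 * 3 * 5 by norm_num,
      Real.log_mul (by norm_num) (by norm_num), Real.log_mul (by norm_num) (by norm_num), Real.log_pow]
    push_cast; ring
  rw [e] at z
  have h2 := Literature.Analysis.SpecialFunctions.Real.log_two_lt_d20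
  have h3 := log_three_le_logThreeHi
  rw [logThreeHi] at h3
  push_cast at h3
  have h5 := log_five_le_logFiveHi
  rw [logFiveHi] at h5
  push_cast at h5
  obtain ⟨z1, z2⟩ := abs_le.1 z
  linarith

/-- lower decimal of `log 59` -/
def logFiftyNineLo : ℚ := 407753744370 / 100000000000
/-- upper decimal of `log 59` -/
def logFiftyNineHi : ℚ := 407753744411 / 100000000000
/-- `logFiftyNineLo ≤ log 59`. -/
theorem logFiftyNineLo_le : (logFiftyNineLo : ℝ) ≤ Real.log 59 := by
  rw [logFiftyNineLo]; push_cast; linarith [log_fiftynine_gt]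
/-- `log 59 ≤ logFiftyNineHi`. -/
theorem log_fiftynine_le_logFiftyNineHi : Real.log 59 ≤ (logFiftyNineHi : ℝ) := by
  rw [logFiftyNineHi]; push_cast; linarith [log_fiftynine_lt]
/-- `7.6811457478686081 ≤ √59 ≤ 7.6811457478686082`. -/
def sqrtFiftyNineLo : ℚ := 76811457478686081 / 10000000000000000
/-- upper decimal of `√59` -/
def sqrtFiftyNineHi : ℚ := 76811457478686082 / 10000000000000000
/-- The atom `59`: weight `log 59/√59`. -/
def atomFiftyNine : ℕ × AtomQ :=
  (59, ⟨logFiftyNineLo, logFiftyNineHi, logFiftyNineLo / sqrtFiftyNineHi, logFiftyNineHi / sqrtFiftyNineLo⟩)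
/-- `atomFiftyNine` encloses the atom `59` for any `S ∋ 59`. -/
theorem atomFiftyNine_encl {S : Finset ℕ} (h : 59 ∈ S) :
    (atomFiftyNine.2.lo : ℝ) ≤ Real.log atomFiftyNine.1 ∧ Real.log atomFiftyNine.1 ≤ (atomFiftyNine.2.hi : ℝ) ∧
      (atomFiftyNine.2.wlo : ℝ) ≤ weilSemilocalCoeff S atomFiftyNine.1 ∧
      weilSemilocalCoeff S atomFiftyNine.1 ≤ (atomFiftyNine.2.whi : ℝ) := by
  simp only [atomFiftyNine]
  push_cast
  have h0 := prime_atom_encl (by norm_num : Nat.Prime 59) h (lo := logFiftyNineLo) (hi := logFiftyNineHi)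
    (slo := sqrtFiftyNineLo) (shi := sqrtFiftyNineHi) (by exact_mod_cast logFiftyNineLo_le)
    (by exact_mod_cast log_fiftynine_le_logFiftyNineHi) (by rw [logFiftyNineLo]; norm_num)
    (ratCast_le_sqrt (by rw [sqrtFiftyNineLo]; norm_num) (by rw [sqrtFiftyNineLo]; norm_num))
    (sqrt_le_ratCast (by rw [sqrtFiftyNineHi]; norm_num) (by rw [sqrtFiftyNineHi]; norm_num))
    (by rw [sqrtFiftyNineLo]; norm_num)
  push_cast at h0
  exact h0

/-! ### The atom `61` (`log 61` from `61 = 60·(1 + 1/60)`) -/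

/-- `(4.11087386397) < log 61` (`Real.abs_log_sub_add_sum_range_le` at `x = -1/60`, 7 terms). -/
theorem log_sixtyone_gt : (4.11087386397 : ℝ) < Real.log 61 := by
  have t : |(-(1 : ℝ) / 60)| < 1 := by rw [abs_of_neg (by norm_num)]; norm_num
  have z := Real.abs_log_sub_add_sum_range_le t 7
  rw [show |(-(1 : ℝ) / 60)| = 1 / 60 by rw [abs_of_neg (by norm_num)]; norm_num] at z
  norm_num [Finset.sum_range_succ] at z
  have e : Real.log (61 / 60) = Real.log 61 - (2 * Real.log 2 + Real.log 3 + Real.log 5) := by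
    rw [Real.log_div (by norm_num) (by norm_num), show (60 : ℝ) = 2 ^ 2 * 3 * 5 by norm_num,
      Real.log_mul (by norm_num) (by norm_num), Real.log_mul (by norm_num) (by norm_num), Real.log_pow]
    push_cast; ring
  rw [e] at z
  have h2 := Literature.Analysis.SpecialFunctions.Real.log_two_gt_d20
  have h3 := logThreeLo_le
  rw [logThreeLo] at h3
  push_cast at h3
  have h5 := logFiveLo_le
  rw [logFiveLo] at h5
  push_cast at h5
  obtain ⟨z1, z2⟩ := abs_le.1 z
  linarith

/-- `log 61 < 4.11087386438` (`Real.abs_log_sub_add_sum_range_le` at `x = -1/60`, 7 terms). -/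
theorem log_sixtyone_lt : Real.log 61 < 4.11087386438 := by
  have t : |(-(1 : ℝ) / 60)| < 1 := by rw [abs_of_neg (by norm_num)]; norm_num
  have z := Real.abs_log_sub_add_sum_range_le t 7
  rw [show |(-(1 : ℝ) / 60)| = 1 / 60 by rw [abs_of_neg (by norm_num)]; norm_num] at z
  norm_num [Finset.sum_range_succ] at z
  have e : Real.log (61 / 60) = Real.log 61 - (2 * Real.log 2 + Real.log 3 + Real.log 5) := by
    rw [Real.log_div (by norm_num) (by norm_num), show (60 : ℝ) = 2 ^ 2 * 3 * 5 by norm_num,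
      Real.log_mul (by norm_num) (by norm_num), Real.log_mul (by norm_num) (by norm_num), Real.log_pow]
    push_cast; ring
  rw [e] at z
  have h2 := Literature.Analysis.SpecialFunctions.Real.log_two_lt_d20
  have h3 := log_three_le_logThreeHi
  rw [logThreeHi] at h3
  push_cast at h3
  have h5 := log_five_le_logFiveHi
  rw [logFiveHi] at h5
  push_cast at h5
  obtain ⟨z1, z2⟩ := abs_le.1 z
  linarith

/-- lower decimal of `log 61` -/
def logSixtyOneLo : ℚ := 411087386397 / 100000000000
/-- upper decimal of `log 61` -/
def logSixtyOneHi : ℚ := 411087386438 / 100000000000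
/-- `logSixtyOneLo ≤ log 61`. -/
theorem logSixtyOneLo_le : (logSixtyOneLo : ℝ) ≤ Real.log 61 := by
  rw [logSixtyOneLo]; push_cast; linarith [log_sixtyone_gt]
/-- `log 61 ≤ logSixtyOneHi`. -/
theorem log_sixtyone_le_logSixtyOneHi : Real.log 61 ≤ (logSixtyOneHi : ℝ) := by
  rw [logSixtyOneHi]; push_cast; linarith [log_sixtyone_lt]
/-- `7.8102496759066543 ≤ √61 ≤ 7.8102496759066544`. -/
def sqrtSixtyOneLo : ℚ := 78102496759066543 / 10000000000000000
/-- upper decimal of `√61` -/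
def sqrtSixtyOneHi : ℚ := 78102496759066544 / 10000000000000000
/-- The atom `61`: weight `log 61/√61`. -/
def atomSixtyOne : ℕ × AtomQ :=
  (61, ⟨logSixtyOneLo, logSixtyOneHi, logSixtyOneLo / sqrtSixtyOneHi, logSixtyOneHi / sqrtSixtyOneLo⟩)
/-- `atomSixtyOne` encloses the atom `61` for any `S ∋ 61`. -/
theorem atomSixtyOne_encl {S : Finset ℕ} (h : 61 ∈ S) :
    (atomSixtyOne.2.lo : ℝ) ≤ Real.log atomSixtyOne.1 ∧ Real.log atomSixtyOne.1 ≤ (atomSixtyOne.2.hi : ℝ) ∧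
      (atomSixtyOne.2.wlo : ℝ) ≤ weilSemilocalCoeff S atomSixtyOne.1 ∧
      weilSemilocalCoeff S atomSixtyOne.1 ≤ (atomSixtyOne.2.whi : ℝ) := by
  simp only [atomSixtyOne]
  push_cast
  have h0 := prime_atom_encl (by norm_num : Nat.Prime 61) h (lo := logSixtyOneLo) (hi := logSixtyOneHi)
    (slo := sqrtSixtyOneLo) (shi := sqrtSixtyOneHi) (by exact_mod_cast logSixtyOneLo_le)
    (by exact_mod_cast log_sixtyone_le_logSixtyOneHi) (by rw [logSixtyOneLo]; norm_num)
    (ratCast_le_sqrt (by rw [sqrtSixtyOneLo]; norm_num) (by rw [sqrtSixtyOneLo]; norm_num))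
    (sqrt_le_ratCast (by rw [sqrtSixtyOneHi]; norm_num) (by rw [sqrtSixtyOneHi]; norm_num))
    (by rw [sqrtSixtyOneLo]; norm_num)
  push_cast at h0
  exact h0

/-! ### The atom `64 = 2⁶` -/

/-- The atom `64 = 2⁶`: `log 64 = 6 log 2`, weight `log 2/8`. -/
def atomSixtyFour : ℕ × AtomQ := (64, ⟨6 * logTwoLo20, 6 * logTwoHi20, logTwoLo20 / 8, logTwoHi20 / 8⟩)
/-- `atomSixtyFour` encloses the atom `64` for any `S ∋ 2`. -/
theorem atomSixtyFour_encl {S : Finset ℕ} (h : 2 ∈ S) :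
    (atomSixtyFour.2.lo : ℝ) ≤ Real.log atomSixtyFour.1 ∧ Real.log atomSixtyFour.1 ≤ (atomSixtyFour.2.hi : ℝ) ∧
      (atomSixtyFour.2.wlo : ℝ) ≤ weilSemilocalCoeff S atomSixtyFour.1 ∧
      weilSemilocalCoeff S atomSixtyFour.1 ≤ (atomSixtyFour.2.whi : ℝ) := by
  simp only [atomSixtyFour]
  rw [show (64 : ℕ) = 2 ^ 6 by norm_num]
  have e64 : Real.sqrt ((2 ^ 6 : ℕ) : ℝ) = 8 := by
    rw [show ((2 ^ 6 : ℕ) : ℝ) = (8 : ℝ) ^ 2 by norm_num, Real.sqrt_sq (by norm_num)]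
  have h0 := pow_atom_encl_of_bounds Nat.prime_two (by norm_num : (6 : ℕ) ≠ 0) h (lo := logTwoLo20)
    (hi := logTwoHi20) (slo := 8) (shi := 8) (by exact_mod_cast logTwoLo20_le)
    (by exact_mod_cast log_two_le_logTwoHi20) (by rw [logTwoLo20]; norm_num) (by rw [e64]; norm_num)
    (by rw [e64]; norm_num) (by norm_num)
  push_cast at h0 ⊢
  exact h0

end Summit.RiemannHypothesis.RiemannHypothesis.Theorems.SemilocalPolyWitness

end
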